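import Mathlib

/-!
# Klein-bottle descent: the two-sided longitude of a one-sided knot dies in strongly real quotients

Solo unit `solo-SmoothPoincare4-informed`, session 15 (HOME `paper/poincare-sphere-trick.md`
§11.10, LEMMA 11.49).  Setting: `N` is the exterior of a one-sided knot `C'` in a non-orientable
3-manifold (for us `C' = C_w/ι ⊂ S¹ ×~ S²`, `N = N_{x*}(w)`); its boundary is a Klein bottle whose
fundamental group `⟨y, m | y m y⁻¹ = m⁻¹⟩` contains the meridian `m` and the one-sided core
direction `y`; the unique two-sided longitude is `e = y²` (it lifts to the `ι`-invariant framing of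
the orientation double cover `C_w ⊂ S¹ × S²`).  The purely group-theoretic content proved here:

* `y m y⁻¹ = m⁻¹` forces `y²` to commute with `m` (`sq_mem_centralizer`);
* hence if the centraliser of (the image of) `m` in a quotient `T` is the cyclic group generated by
  `m` — as for every non-trivial element of `A₅` and of `PSL(2,7)` — then `e = y²` is inverted AND
  fixed by conjugation with `y`, so `e² = 1` (`sq_sq_eq_one`); and if moreover `m` has odd order then
  `e = 1` (`sq_eq_one_of_odd_orderOf`).

Consequence used in the paper (COMPUTATION 11.48, LEMMA 11.49): every `A₅`- or `PSL(2,7)`-valued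
certificate `ρ` of `π₁(N_{x*}(w))` with `ρ(m)` of odd order kills the canonical longitude, i.e. factors
through the orbifold group `π₁(N)/⟨⟨y²⟩⟩`, and therefore its restriction to the orientation subgroup
descends to the fundamental group of the canonical homology sphere `Σ^ι_w = V_{x*}(w)(e)`; in the
binary icosahedral group `SL(2,5)` the same argument gives `ρ(e) = -1` (normalisers of the cyclic
subgroups of order 6 and 10 are binary dihedral, whose non-cyclic elements square to `-1`).
-/

namespace Summit.SmoothPoincare4.SmoothPoincare4.Theorems
namespace KleinDescent

variable {T : Type*} [Group T]

/-- Conjugation by `y` inverts every integer power of an element it inverts. -/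
theorem conj_zpow_eq_inv {y m : T} (h : y * m * y⁻¹ = m⁻¹) (i : ℤ) :
    y * m ^ i * y⁻¹ = (m ^ i)⁻¹ := by
  have h1 : MulAut.conj y m = m⁻¹ := by simpa [MulAut.conj_apply] using h
  have h2 : MulAut.conj y (m ^ i) = (m ^ i)⁻¹ := by
    rw [map_zpow, h1, inv_zpow]
  simpa [MulAut.conj_apply] using h2

/-- In the Klein bottle relation `y m y⁻¹ = m⁻¹`, the square `y²` (the two-sided longitude)
commutes with the meridian `m`. -/
theorem sq_mul_comm {y m : T} (h : y * m * y⁻¹ = m⁻¹) : y ^ 2 * m = m * y ^ 2 := by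
  have h1 : y * m = m⁻¹ * y := by
    calc y * m = y * m * y⁻¹ * y := by group
      _ = m⁻¹ * y := by rw [h]
  have h2 : y * m⁻¹ = m * y := by
    calc y * m⁻¹ = y * m⁻¹ * y⁻¹ * y := by group
      _ = (y * m * y⁻¹)⁻¹ * y := by group
      _ = m * y := by rw [h, inv_inv]
  calc y ^ 2 * m = y * (y * m) := by rw [pow_two, mul_assoc]
    _ = y * (m⁻¹ * y) := by rw [h1]
    _ = (y * m⁻¹) * y := by group
    _ = (m * y) * y := by rw [h2]
    _ = m * y ^ 2 := by rw [pow_two, mul_assoc]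

/-- `y²` lies in the centraliser of `m`. -/
theorem sq_mem_centralizer {y m : T} (h : y * m * y⁻¹ = m⁻¹) :
    y ^ 2 ∈ Subgroup.centralizer ({m} : Set T) := by
  rw [Subgroup.mem_centralizer_iff]
  intro g hg
  rw [Set.mem_singleton_iff] at hg
  subst hg
  exact (sq_mul_comm h).symm

/-- KLEIN DESCENT, involution form: if `y` inverts `m` and the centraliser of `m` is the cyclic
group generated by `m`, then the longitude `e = y²` satisfies `e² = 1`. -/
theorem sq_sq_eq_one {y m : T} (h : y * m * y⁻¹ = m⁻¹)
    (hc : Subgroup.centralizer ({m} : Set T) ≤ Subgroup.zpowers m) : (y ^ 2) ^ 2 = 1 := by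
  obtain ⟨i, hi⟩ := Subgroup.mem_zpowers_iff.mp (hc (sq_mem_centralizer h))
  -- conjugation by `y` fixes `y²` and inverts `m ^ i = y²`
  have hinv : y * y ^ 2 * y⁻¹ = (y ^ 2)⁻¹ := by rw [← hi]; exact conj_zpow_eq_inv h i
  have hfix : y * y ^ 2 * y⁻¹ = y ^ 2 := by group
  have h3 : y ^ 2 = (y ^ 2)⁻¹ := hfix.symm.trans hinv
  rw [pow_two (y ^ 2)]
  exact mul_eq_one_iff_eq_inv.mpr h3

/-- KLEIN DESCENT, odd-order form: if in addition `m` has odd order then `y² = 1`, i.e. the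
representation kills the two-sided longitude. -/
theorem sq_eq_one_of_odd_orderOf {y m : T} (h : y * m * y⁻¹ = m⁻¹)
    (hc : Subgroup.centralizer ({m} : Set T) ≤ Subgroup.zpowers m) (hodd : Odd (orderOf m)) :
    y ^ 2 = 1 := by
  have h2 : orderOf (y ^ 2) ∣ 2 := orderOf_dvd_of_pow_eq_one (sq_sq_eq_one h hc)
  have hm : orderOf (y ^ 2) ∣ orderOf m := orderOf_dvd_of_mem_zpowers (hc (sq_mem_centralizer h))
  have hcop : Nat.Coprime 2 (orderOf m) := Nat.coprime_two_left.mpr hodd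
  have h1 : orderOf (y ^ 2) ∣ 1 := by
    have hg : orderOf (y ^ 2) ∣ Nat.gcd 2 (orderOf m) := Nat.dvd_gcd h2 hm
    rwa [Nat.Coprime.gcd_eq_one hcop] at hg
  exact orderOf_eq_one_iff.mp (Nat.dvd_one.mp h1)

/-- The same conclusions pushed through a homomorphism `ρ : G →* T` from a group containing the
Klein bottle relation (the form in which the paper uses it: `G = π₁(N)`, `T` finite). -/
theorem map_sq_eq_one_of_odd_orderOf {G : Type*} [Group G] (ρ : G →* T) {y m : G}
    (h : y * m * y⁻¹ = m⁻¹)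
    (hc : Subgroup.centralizer ({ρ m} : Set T) ≤ Subgroup.zpowers (ρ m))
    (hodd : Odd (orderOf (ρ m))) : ρ (y ^ 2) = 1 := by
  have h' : ρ y * ρ m * (ρ y)⁻¹ = (ρ m)⁻¹ := by
    have := congrArg ρ h
    simpa [map_mul, map_inv] using this
  rw [map_pow]
  exact sq_eq_one_of_odd_orderOf h' hc hodd

end KleinDescent
end Summit.SmoothPoincare4.SmoothPoincare4.Theorems
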